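import Literature.NumberTheory.EllipticCurves.Kato2004.EulerSystemClasses
import Literature.NumberTheory.EllipticCurves.KatoFineSelmerDualProofs
import HarnessLib

/-!
# Kato 2004 (Astérisque 295), §17.13 package RESTATED with print-verbatim integral shadows of the zeta
# line (Thm. 12.5 (1)(2), Thm. 12.6, Thm. 16.6 (2), 17.5, Prop. 17.11, p. 280) in place of the derived
# field `image_zeta_localized` — ONE construction fact (`exists_divisibilityInputsZetaLine_fineQuotient_zeta`)
# and the THEOREM that it yields the tree's `exists_divisibilityInputs_fineQuotient_zeta`

Topic `NumberTheory/EllipticCurves`, sub-directory `Kato2004` (namespace = path).  Print cell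
`bsd-print-x9` (D-0131 (2), leaves ClassX9 + ClassX10b of `BirchSwinnertonDyer`), seat `ty1` (typer), at
the request of seat p3 (HOME INBOX 2026-08-27T13:33:52Z) endorsed by the cell referee (REF-AUDIT §1d
RUL-3, 13:29:30Z).  Statements first; no notation; nothing asserted beyond ONE construction fact.

## Why a restatement (honest framing)

The tree's §17.13 package `Kato2004.DivisibilityInputs W p f κ γ I D` (file `DivisibilityInputs`) carries
a field `image_zeta_localized`: under `Irr(E[p])`, for `G₁ ∈ Λ` with `ι G₁ = L_p(E,T)` and EVERY
height-one prime `𝔭` of `Λ = ℤ_p⟦T⟧`, some `s ∉ 𝔭` has `s·G₁ ∈ col(loc Z)` and `s·col(loc z) ∈ (G₁)`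
for all `z ∈ Z`.  That sentence is not printed as such: it is a CONSEQUENCE of printed statements, and
its derivation at `𝔭 = (p)` was for a while priced by a registry flag (`Kato04-p280-image_zeta_localized@
Irr-only@p`) because Kato's p. 280 paragraph opens with "In the case `𝔭` contains `p`, we assume `p ≠ 2`
and that the condition (12.5.2) in 12.5 (4) is satisfied" [p. 280, L7–8 of the held scan p0165].  The
cell's reading of record (p3 memo HOME/p3/F1-IMAGE-ZETA-AT-P.md (a)–(g); referee RUL-3): that assumption
prices the INEQUALITY of the paragraph (fed by Thm. 12.5 (4)), not the identification sentence "By 17.11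
and by 12.5, 16.6, we have an isomorphism `𝐇¹_loc(T(k))_𝔭/𝐇¹_loc(T'(k))_𝔭 ≅ Λ_𝔭` which sends the
image of `Z(f,T)(k)_𝔭` (12.5 (4)) onto `Λ_𝔭 · L_{p-adic,α,ω,γ}(f)`" [p. 280, L19–22], whose inputs
12.5 (1)(2), 12.6, 16.6 (2), 17.5, 17.11 carry no image hypothesis.  This file therefore REPLACES the
derived field by two INTEGRAL SHADOWS that use only the package's own objects (`Z ≤ 𝐇¹`, `loc`, `col`,
`G₁`) — no `𝐇¹ ⊗ ℚ`, no `z_γ` — and PROVES the old field from them (pure algebra in `Λ`; kernel form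
first landed Summits-side as `Summit.…Rank1Residual.ZetaImage.imageLocalized_of_zetaLine`, p535554,
REF-16 PASS; re-proved here because `Literature/` cannot import `Summits/`):

* (F1a) `exists_zetaLine` — «the zeta line through Thm. 12.6's finite index»: naturals `m`, a unit
  `u ∈ Λˣ`, elements `wp, wT ∈ Z` with `T^m • wp = p^m • wT`, `col(loc wp) = p^m·u·G₁`,
  `col(loc wT) = T^m·u·G₁`.  READING: `γ₀ ∈ T` good (17.5 [p. 274]: `γ₀^±` bases of `T^±`), `z_{γ₀} ∈
  Z(f,T) ⊂ 𝐇¹(T) ⊗ ℚ` (12.5 (1), definition of `Z(f,T)` in 12.5 (4) [p. 222]); `Z(f,T)/Z` FINITE (Thm.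
  12.6 [p. 222]: "Then `Z ⊂ Z(f,T)` and `Z(f,T)/Z` is a finite group"), so `𝔪^m·Z(f,T) ⊂ Z` for
  `𝔪 = (p,T)` and some `m`; `wp := p^m z_{γ₀}`, `wT := T^m z_{γ₀}`; `col(loc z_{γ₀}) = 𝔏_η(z_{γ₀}) =
  L_{p-adic,α,ω,γ₀}(f)` (Thm. 16.6 (2) [p. 271] with `ω` the Néron differential, good for `T` by 17.5,
  and `col = 𝔏_η` of Prop. 17.11 [p. 277]) `= u · G₁` with `u ∈ Λˣ`: the period-ratio unit `ϖ ∈ ℤ_pˣ`,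
  `ϖ·Ω_E = Ω⁺_f` up to `c_∞ ∈ {1, 2}` and sign (tree facts `realPeriodRat_eq_unit_mul_plusPeriod` (A25,
  `p ≥ 5`) resp. its `p = 3` companion `realPeriodRat_eq_unit_mul_plusPeriod_three`; Greenberg–Vatsal
  2000 §3), times the functional-equation unit of `L_p(E,T)` if the orientations `γ ↔ γ⁻¹` of the two
  `Λ`-structures differ (Mazur–Tate–Teitelbaum §I.17; module docstring of `DivisibilityInputs.lean`), and
  `L_p(f,α) = ι G₁` with `G₁ ∈ Λ` (Greenberg–Vatsal Prop. 3.7, tree THEOREM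
  `padicLFunction_mem_iwasawaAlgebra_holds`).  The field only asserts `∃ u ∈ Λˣ`.
* (F1b) `col_loc_mem_span` — «`Z ⊂ Z(f,T)` (Thm. 12.6) and `col(loc Z(f,T)) = Λ·u·G₁` (12.5 (1):
  `γ ↦ z_γ` is `F_λ`-linear; on the `Δ`-trivial component `𝔏_η(z_γ) = a(γ)·𝔏_η(z_{γ₀})` with `a(γ) ∈ ℤ_p`
  the `γ₀⁺`-coordinate of `γ⁺`, by 16.6 (2) and Thm. 17.4 (2)'s `γ^± ≠ 0` convention [p. 273])»:
  `col(loc z) ∈ (G₁)` for every `z ∈ Z` — the integral shadow of the p. 280 sentence quoted above.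

THEN (`DivisibilityInputsZetaLine.image_zeta_localized`, proved): at a height-one `𝔭 ∋ p` one has
`𝔭 = (p)` (`(p)` is a height-one prime: tree theorems `IwasawaAlgebra.isPrime_augIdealP_holds`,
`height_augIdealP_holds`; Mathlib `Ideal.eq_of_le_of_height_le`) and the witness `s = T^m ∉ (p)` works
through `wT`; at `𝔭 ∌ p` the witness `s = p^m` works through `wp`; the second clause holds for every `s`
by (F1b).  No (12.5.2) anywhere.  `Irr(E[p])` enters (F1a)/(F1b) exactly as it entered the old field:
lattice homothety `T_pE ∼ V_{ℤ_p}(f)` (tree `Kato2004/StableLatticeHomothetyProofs.lean`) and the period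
unit.

## What is here

* `DivisibilityInputsZetaLine W p f κ γ I D` — hypothesis structure: every field of
  `Kato2004.DivisibilityInputs` other than `image_zeta_localized` (30 fields, the six bundled instance
  fields included), BYTE-IDENTICAL (names, types, docstrings, order), followed by the two shadows (F1b)
  `col_loc_mem_span` and (F1a) `exists_zetaLine`.
* `DivisibilityInputsZetaLine.image_zeta_localized` (THEOREM: the old field, verbatim) and
  `DivisibilityInputsZetaLine.toDivisibilityInputs` (the old package, all shared fields definitionally
  equal: `toDivisibilityInputs_Z/_loc/_col/_toX/_δ/_G` are `rfl`), with the algebra lemmas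
  `eq_augIdealP_of_height_eq_one_of_C_mem`, `X_pow_notMem_of_height_eq_one_of_C_mem`,
  `imageLocalized_of_zetaLine` (abstract `Λ`-modules; one private helper).
* `exists_divisibilityInputsZetaLine_fineQuotient_zeta` — ONE construction fact, the restated F1: same
  outer binders and same three clauses (surjective fine quotient `π`, exactness after `P → X`, Thm. 12.6
  span clause `K.Z ≤ span {IsEulerSystemClass}`) as `Kato2004.exists_divisibilityInputs_fineQuotient_zeta`
  (file `EulerSystemClasses`), with the package replaced by `DivisibilityInputsZetaLine`.
* THEOREMS `exists_divisibilityInputs_fineQuotient_zeta_of_zetaLine` (restated F1 ⟹ old F1 — every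
  consumer of the old fact ports by feeding this term), `exists_divisibilityInputs_fineQuotient_of_zetaLine`,
  `nonempty_divisibilityInputs_of_zetaLine` (the old package `DivisibilityInputs` is inhabited).

The old fact and structure are KEPT (the X10 lane's records cite them); nothing is renamed or removed.
Weaker-than-print as before (`P, 𝐇², 𝐇²_loc, π` forgotten up to the listed properties; `Z` bounded above
by the span); the two new fields are composites of the printed statements listed, never stronger; no
`_holds` expected soon (construction fact, D-0014).

## References (K. Kato, Astérisque 295 (2004); `[p. N]` printed page = PDF page `N − 115` of the held
text `paper:doi-10-24033-ast-639`, re-read 2026-08-27: p0106–p0108, p0156–p0159, p0162, p0164–p0165)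

* Thm. 12.5 (1)(2) [p. 221, p0106 L19–62]; Thm. 12.5 (4) with (12.5.2) [p. 222, p0107 L13–35]; Thm. 12.6
  [p. 222, p0107 L36–48]; proofs §13 (non-CM) / §15 (CM) [p. 223, p0108 L35–37]; Thm. 16.6 [p. 271,
  p0156 L13–35]; Thm. 17.4 (2) [p. 273, p0158 L30–34]; 17.5 [p. 274, p0159 L5–11]; Prop. 17.11 [p. 277,
  p0162 L29–44]; §17.13 [p. 279, p0164 L18–21 and (17.13.1) L27–41; p. 280, p0165 L7–22].
  [Kato2004Asterisque]
* R. Greenberg, V. Vatsal, Invent. Math. 142 (2000), §3 Remark 3.4, Prop. 3.7. [GreenbergVatsal2000]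
* B. Mazur, J. Tate, J. Teitelbaum, Invent. Math. 84 (1986), §I.17 (functional equation of `L_p`).
  [MazurTateTeitelbaum1986]
* L. Washington, *Introduction to Cyclotomic Fields*, GTM 83, §13.2 (height-one primes of `Λ`).
  [Washington1997]
* Tree: `Kato2004/DivisibilityInputs.lean` (the old package and its module docstring READING, which this
  file inherits verbatim), `Kato2004/DivisibilityInputsFine.lean`, `Kato2004/EulerSystemClasses.lean`
  (old F1), `Summits/…/Theorems/PrintX9KatoZetaImageLocalized.lean` (p3's kernel algebra, p535554),
  cell files HOME/p3/F1-IMAGE-ZETA-AT-P.md, HOME/REF-AUDIT.md §1d RUL-2/RUL-3.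
-/

noncomputable section

open scoped MatrixGroups ModularForm
open Field CongruenceSubgroup
open Literature.NumberTheory.GaloisRepresentations
open Literature.NumberTheory.EllipticCurves Literature.NumberTheory.EllipticCurves.ModularForms
open Literature.NumberTheory.EllipticCurves.Kato2004.EulerSystemValues
open Literature.NumberTheory.EllipticCurves.IwasawaAlgebra

namespace Literature.NumberTheory.EllipticCurves.Kato2004

open Module

/-! ## Algebra in `Λ = ℤ_p⟦T⟧`: the localized image of the zeta module from the two integral shadows -/

section Algebra

variable {p : ℕ} [Fact p.Prime]

/-- **A height-one prime of `Λ = ℤ_p⟦T⟧` containing `p` is `(p)`**: `(p)` is prime of height one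
(`isPrime_augIdealP_holds`, `height_augIdealP_holds`), and a prime above a prime of the same finite
height equals it (`Ideal.eq_of_le_of_height_le`).  Literature-side restatement of
`Summit.BirchSwinnertonDyer.BirchSwinnertonDyer.Rank1Residual.ZetaImage.eq_augIdealP_of_height_eq_one_of_C_mem`
(p535554; `Literature/` cannot import `Summits/`). [cite: Washington1997, §13.2] -/
theorem eq_augIdealP_of_height_eq_one_of_C_mem (𝔭 : PrimeSpectrum (IwasawaAlgebra p))
    (h1 : 𝔭.asIdeal.height = 1) (hp : (PowerSeries.C (p : ℤ_[p]) : IwasawaAlgebra p) ∈ 𝔭.asIdeal) :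
    𝔭.asIdeal = augIdealP p := by
  haveI : (augIdealP p).IsPrime := isPrime_augIdealP_holds p
  have hle : augIdealP p ≤ 𝔭.asIdeal := by
    rw [augIdealP, Ideal.span_singleton_le_iff_mem]
    exact hp
  have hh : 𝔭.asIdeal.height ≤ (augIdealP p).height := by
    rw [h1, show (augIdealP p).height = 1 from height_augIdealP_holds p]
  exact (Ideal.eq_of_le_of_height_le (augIdealP p) hle hh).symm

/-- **`T^m ∉ 𝔭` for a height-one prime `𝔭 ∋ p` of `ℤ_p⟦T⟧`**: then `𝔭 = (p)` and `T ∉ (p)` (the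
coefficient of `T¹` in `T` is `1`, not divisible by `p`).  Literature-side restatement of
`Summit.BirchSwinnertonDyer.BirchSwinnertonDyer.Rank1Residual.ZetaImage.X_pow_notMem_of_height_eq_one_of_C_mem`
(p535554). [cite: Washington1997, §13.2] -/
theorem X_pow_notMem_of_height_eq_one_of_C_mem (𝔭 : PrimeSpectrum (IwasawaAlgebra p))
    (h1 : 𝔭.asIdeal.height = 1) (hp : (PowerSeries.C (p : ℤ_[p]) : IwasawaAlgebra p) ∈ 𝔭.asIdeal)
    (m : ℕ) : (PowerSeries.X : IwasawaAlgebra p) ^ m ∉ 𝔭.asIdeal := by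
  intro h
  have hX := 𝔭.isPrime.mem_of_pow_mem m h
  rw [eq_augIdealP_of_height_eq_one_of_C_mem 𝔭 h1 hp] at hX
  have hc := (mem_augIdealP_iff (p := p) PowerSeries.X).mp hX 1
  rw [PowerSeries.coeff_one_X] at hc
  exact (PadicInt.irreducible_p (p := p)).not_isUnit (isUnit_of_dvd_one hc)

/-- **`p^m ∉ 𝔭` for a prime `𝔭 ∌ p`** (private helper). [folklore] -/
private theorem C_pow_notMem_of_C_notMem (𝔭 : PrimeSpectrum (IwasawaAlgebra p))
    (hp : (PowerSeries.C (p : ℤ_[p]) : IwasawaAlgebra p) ∉ 𝔭.asIdeal) (m : ℕ) :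
    (PowerSeries.C (p : ℤ_[p]) : IwasawaAlgebra p) ^ m ∉ 𝔭.asIdeal :=
  fun h ↦ hp (𝔭.isPrime.mem_of_pow_mem m h)

/-- **The localized image of the zeta module from the two integral shadows (algebra of Kato p. 280
without (12.5.2)).**  `H, P` are `Λ`-modules (reading: `H = 𝐇¹_Γ(T)`, `P` the local quotient of
(17.13.3)), `loc : H → P`, `col : P → Λ` linear ((17.13.1) and the Coleman map of Prop. 17.11), `Z ≤ H`
(Thm. 12.6) and `G₁ ∈ Λ` (the integral `p`-adic `L`-function).  Assume (F1a) `wp, wT ∈ Z` with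
`col(loc wp) = p^m·u·G₁`, `col(loc wT) = T^m·u·G₁`, `u` a unit, and (F1b) `col(loc z) ∈ (G₁)` for every
`z ∈ Z`.  Then for every height-one prime `𝔭` some `s ∉ 𝔭` has `s·G₁ ∈ col(loc Z)` and
`s·col(loc z) ∈ (G₁)` for all `z ∈ Z` — the field `DivisibilityInputs.image_zeta_localized`, verbatim.
Witnesses `s = T^m` (via `u⁻¹ • wT`) if `p ∈ 𝔭`, `s = p^m` (via `u⁻¹ • wp`) otherwise.  Literature-side
restatement of `Summit.BirchSwinnertonDyer.BirchSwinnertonDyer.Rank1Residual.ZetaImage.imageLocalized_of_zetaLine`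
(p535554, cell referee REF-16 PASS).
[cite: Kato2004Asterisque, Thm. 12.6 (p. 222), Thm. 16.6 (2) (p. 271), Prop. 17.11 (p. 277) and §17.13 (p. 280)]
[cite: Washington1997, §13.2] -/
theorem imageLocalized_of_zetaLine {H P : Type*} [AddCommGroup H]
    [_root_.Module (IwasawaAlgebra p) H] [AddCommGroup P] [_root_.Module (IwasawaAlgebra p) P]
    (loc : H →ₗ[IwasawaAlgebra p] P) (col : P →ₗ[IwasawaAlgebra p] IwasawaAlgebra p)
    (Z : Submodule (IwasawaAlgebra p) H) (G₁ : IwasawaAlgebra p)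
    (m : ℕ) (u : (IwasawaAlgebra p)ˣ) (wp wT : H) (hwp : wp ∈ Z) (hwT : wT ∈ Z)
    (hcol_wp : col (loc wp) = (PowerSeries.C (p : ℤ_[p]) : IwasawaAlgebra p) ^ m * u * G₁)
    (hcol_wT : col (loc wT) = (PowerSeries.X : IwasawaAlgebra p) ^ m * u * G₁)
    (hZ : ∀ z ∈ Z, col (loc z) ∈ Ideal.span {G₁}) :
    ∀ 𝔭 : PrimeSpectrum (IwasawaAlgebra p), 𝔭.asIdeal.height = 1 →
      ∃ s : IwasawaAlgebra p, s ∉ 𝔭.asIdeal ∧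
        s * G₁ ∈ Submodule.map (col ∘ₗ loc) Z ∧
        ∀ z ∈ Z, s * col (loc z) ∈ Ideal.span {G₁} := by
  intro 𝔭 h1
  -- the second clause holds for ANY `s`, by (F1b)
  have hclause2 : ∀ (s : IwasawaAlgebra p), ∀ z ∈ Z, s * col (loc z) ∈ Ideal.span {G₁} :=
    fun s z hz ↦ Ideal.mul_mem_left _ s (hZ z hz)
  -- a witness `w ∈ Z` with `col(loc w) = t·u·G₁` gives the first clause for `s = t` via `u⁻¹ • w`
  have hclause1 : ∀ (t : IwasawaAlgebra p) (w : H), w ∈ Z → col (loc w) = t * u * G₁ →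
      t * G₁ ∈ Submodule.map (col ∘ₗ loc) Z := by
    intro t w hw hcw
    refine ⟨(↑u⁻¹ : IwasawaAlgebra p) • w, Z.smul_mem _ hw, ?_⟩
    rw [LinearMap.comp_apply, map_smul, map_smul, hcw, smul_eq_mul]
    calc (↑u⁻¹ : IwasawaAlgebra p) * (t * ↑u * G₁) = t * ((↑u⁻¹ : IwasawaAlgebra p) * ↑u) * G₁ := by
          ring
      _ = t * G₁ := by rw [Units.inv_mul, mul_one]
  by_cases hp : (PowerSeries.C (p : ℤ_[p]) : IwasawaAlgebra p) ∈ 𝔭.asIdeal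
  · -- `𝔭 = (p)`: witness `T^m` through `wT`
    exact ⟨(PowerSeries.X : IwasawaAlgebra p) ^ m, X_pow_notMem_of_height_eq_one_of_C_mem 𝔭 h1 hp m,
      hclause1 _ wT hwT hcol_wT, hclause2 _⟩
  · -- `𝔭 ∌ p`: witness `p^m` through `wp`
    exact ⟨(PowerSeries.C (p : ℤ_[p]) : IwasawaAlgebra p) ^ m, C_pow_notMem_of_C_notMem 𝔭 hp m,
      hclause1 _ wp hwp hcol_wp, hclause2 _⟩

end Algebra

/-! ## The restated package: `DivisibilityInputs` with the two integral shadows in place of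
`image_zeta_localized` -/

section Package

variable (W : WeierstrassCurve ℚ) [W.IsElliptic] [W.IsGloballyMinimal] (p : ℕ) [Fact p.Prime]
  [ContinuousSMul ℤ_[p] (W.tateModule p)] {N : ℕ} [NeZero N] (f : CuspForm (Gamma0 N) 2)
  (κ : ZpExtension ℚ p) (γ : absoluteGaloisGroup ℚ)
  (I : IwasawaH1Data W p κ γ) (D : W.SelmerDualData κ γ)

/-- **Kato's §17.13 inputs on `(𝐇¹_Γ(T_pW), X(E/ℚ_∞))` with the zeta line — hypothesis structure
(nothing asserted).**  Fields `P … integral`: BYTE-IDENTICAL with `Kato2004.DivisibilityInputs` (same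
file's docstrings: (12.2.1) + Thm. 12.4 (1); (17.13.1)–(17.13.3) for `p ≠ 2`; (17.13.4); Prop. 17.11;
Thm. 16.6 (2) with 12.5 (1)(2), 12.6, p. 279 (`pow_mem`); Thm. 12.5 (3) at `𝔭 ∌ p` (`es_bound`); Thm.
12.5 (4) with 17.4 (3) under the surjectivity hypothesis of `kato_divisibility` (3) (`integral`)).  In
place of the derived field `image_zeta_localized` of the old package, the two INTEGRAL SHADOWS of the
printed zeta line, both under `Irr(E[p])` and for `G₁ ∈ Λ` with `ι G₁ = L_p(E,T)` exactly like the old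
field: (F1b) `col_loc_mem_span` — Thm. 12.6 "`Z ⊂ Z(f,T)`" with Thm. 12.5 (1) (linearity of `γ ↦ z_γ`),
Thm. 16.6 (2), 17.5, Prop. 17.11 and p. 280 "sends the image of `Z(f,T)_𝔭` onto `Λ_𝔭 · L`":
`col(loc Z) ⊆ Λ·G₁`; (F1a) `exists_zetaLine` — Thm. 12.6 "`Z(f,T)/Z` is a finite group" (so
`𝔪^m Z(f,T) ⊂ Z`) with 16.6 (2) + 17.11 + 17.5 for a good `γ₀` (`col(loc z_{γ₀}) = u·G₁`, `u` the
period-ratio unit of Greenberg–Vatsal §3 / tree A25): `wp = p^m z_{γ₀}`, `wT = T^m z_{γ₀}` lie in `Z`,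
`T^m • wp = p^m • wT`, `col(loc wp) = p^m·u·G₁`, `col(loc wT) = T^m·u·G₁`.  The old field is then the
THEOREM `DivisibilityInputsZetaLine.image_zeta_localized` (module docstring; no (12.5.2)).
[cite: Kato2004Asterisque, Thm. 12.4 (1) (p. 221), Thm. 12.5 (1)–(4) (pp. 221–222), Thm. 12.6 (p. 222), Thm. 16.6 (p. 271), Thm. 17.4 (2) (p. 273), 17.5 (p. 274), Prop. 17.11 (p. 277), §17.13 (17.13.1)–(17.13.4) and p. 280 (pp. 279–280)]
[cite: GreenbergVatsal2000, §3 Remark 3.4 and Prop. 3.7] -/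
structure DivisibilityInputsZetaLine where
  /-- `P = 𝐇¹_loc(T(k))/𝐇¹_loc(T'(k))` ((17.13.3)), abstract. -/
  P : Type
  /-- `H2 = 𝐇²(T(k))` (`Δ`-trivial component), abstract. -/
  H2 : Type
  /-- `H2loc = 𝐇²_loc(T(k))`, abstract. -/
  H2loc : Type
  [addCommGroupP : AddCommGroup P]
  [moduleP : _root_.Module (IwasawaAlgebra p) P]
  [addCommGroupH2 : AddCommGroup H2]
  [moduleH2 : _root_.Module (IwasawaAlgebra p) H2]
  [addCommGroupH2loc : AddCommGroup H2loc]
  [moduleH2loc : _root_.Module (IwasawaAlgebra p) H2loc]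
  /-- (12.2.1): `𝐇²` is a finitely generated `Λ`-module. -/
  finite_H2 : Module.Finite (IwasawaAlgebra p) H2
  /-- Thm. 12.4 (1): `𝐇²` is a torsion `Λ`-module. -/
  isTorsion_H2 : Module.IsTorsion (IwasawaAlgebra p) H2
  /-- (17.13.1): `𝐇¹ → P` (localisation at `p` followed by the quotient by `𝐇¹_loc(T')`). -/
  loc : I.H →ₗ[IwasawaAlgebra p] P
  /-- (17.13.1): `P → 𝔛 = X(E/ℚ_∞)`. -/
  toX : P →ₗ[IwasawaAlgebra p] D.X
  /-- (17.13.1): `𝔛 → 𝐇²`. -/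
  δ : D.X →ₗ[IwasawaAlgebra p] H2
  /-- (17.13.1): `𝐇² → 𝐇²_loc`. -/
  ε : H2 →ₗ[IwasawaAlgebra p] H2loc
  /-- (17.13.2) (`lim← H¹_f(ℤ[ζ_{p^n},1/p], T(r)) = 0`, p. 279): `𝐇¹ → P` is injective. -/
  loc_injective : Function.Injective loc
  /-- (17.13.1) with (17.13.3), `p ≠ 2`: exactness at `P`. -/
  exact_P : Function.Exact loc toX
  /-- (17.13.1), `p ≠ 2`: exactness at `𝔛`. -/
  exact_X : Function.Exact toX δ
  /-- (17.13.1), `p ≠ 2`: exactness at `𝐇²`. -/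
  exact_H2 : Function.Exact δ ε
  /-- (17.13.4) (latter half of Thm. 12.5 (3); `f` potentially good at `p`): `𝐇²_loc` is finite. -/
  finite_H2loc : Finite H2loc
  /-- Prop. 17.11: the Coleman map `𝔏_η` induces an injection `P ↪ Λ` … -/
  col : P →ₗ[IwasawaAlgebra p] IwasawaAlgebra p
  /-- Prop. 17.11: … which is injective … -/
  col_injective : Function.Injective col
  /-- Prop. 17.11: … with finite cokernel. -/
  finite_coker_col : Finite (IwasawaAlgebra p ⧸ LinearMap.range col)
  /-- Thm. 12.6: the `Λ`-span `Z ⊂ 𝐇¹(T)` of the integral zeta elements (8.1.3)/(8.11) (all admissible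
  `c, d, j, a(A)` resp. `α`), projected to the `Δ`-trivial component. -/
  Z : Submodule (IwasawaAlgebra p) I.H
  /-- The `p`-power denominator of 17.4 (2) "`L_{p-adic} ∈ Λ ⊗ ℚ`" (p. 279: from 17.11 and 16.6). -/
  n : ℕ
  /-- `G = p^n · L_p(E,T)` as an element of `Λ`. -/
  G : IwasawaAlgebra p
  /-- `ι G = p^n · L_p(E,T)` in `ℚ_p⟦T⟧` (17.4 (2), p. 279). -/
  ιG_eq : iwasawaToPowerSeries p G =
    PowerSeries.C ((p : ℚ_[p]) ^ n) * padicLFunction f (unitRoot W p : ℚ_[p])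
  /-- Thm. 16.6 (2) with 12.5 (1) and 12.6 (`p^m Z(f,T) ⊂ Z`): `G ∈ col(loc Z)`. -/
  pow_mem : G ∈ Submodule.map (col ∘ₗ loc) Z
  /-- Thm. 12.5 (3) (via Thm. 13.4 (2)) at the height-one primes `𝔭 ∌ p`, printed shape:
  `length 𝐇²_𝔭 ≤ length (𝐇¹/Z)_𝔭 + length (𝐇²_loc)_𝔭` (`Z(f)_𝔭 = Z_𝔭` there). -/
  es_bound : ∀ 𝔭 : PrimeSpectrum (IwasawaAlgebra p), 𝔭.asIdeal.height = 1 →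
    PowerSeries.C (p : ℤ_[p]) ∉ 𝔭.asIdeal →
      lengthAt (IwasawaAlgebra p) H2 𝔭 ≤
        lengthAt (IwasawaAlgebra p) (I.H ⧸ Z) 𝔭 + lengthAt (IwasawaAlgebra p) H2loc 𝔭
  /-- Thm. 12.5 (4) with 17.4 (3) (p. 279 "`L ∈ Λ`"), under the surjectivity hypothesis of
  `kato_divisibility` (3) (which implies (12.5.2); (12.5.1) excluded by good reduction): the integral
  zeta submodule `Z' = Z(f,T) ⊂ 𝐇¹` with `L_p = ι G' ∈ col(loc Z')` and the inequality at EVERY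
  height-one prime — verbatim the `hint` binder of `Kato2004.kato_divisibility_body_of_skeleton`. -/
  integral : (∀ m : ℕ, W.HasSurjectiveModNGaloisRep (p ^ m : ℕ)) →
    ∃ (Z' : Submodule (IwasawaAlgebra p) I.H) (G' : IwasawaAlgebra p),
      G' ∈ Submodule.map (col ∘ₗ loc) Z' ∧
      iwasawaToPowerSeries p G' = padicLFunction f (unitRoot W p : ℚ_[p]) ∧
      ∀ 𝔭 : PrimeSpectrum (IwasawaAlgebra p), 𝔭.asIdeal.height = 1 →
        lengthAt (IwasawaAlgebra p) H2 𝔭 ≤ lengthAt (IwasawaAlgebra p) (I.H ⧸ Z') 𝔭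
  /-- (F1b) Thm. 12.6 (p. 222) "`Z ⊂ Z(f,T)`" with Thm. 12.5 (1) (`γ ↦ z_γ` is `F_λ`-linear, p. 221),
  Thm. 16.6 (2) (p. 271: `𝔏_η(z_γ) = L_{p-adic,α,ω,γ}(f)`), 17.5 (p. 274: Néron `ω`, good `γ₀`),
  Prop. 17.11 (p. 277: `col = 𝔏_η`) and p. 280 "sends the image of `Z(f,T)_𝔭` onto
  `Λ_𝔭 · L_{p-adic,α,ω,γ}(f)`": under `Irr(E[p])` (lattice homothety; period-ratio unit `u`, A25 /
  Greenberg–Vatsal §3; `L_p(f,α) ∈ ι Λ`, Greenberg–Vatsal Prop. 3.7), for `G₁ ∈ Λ` with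
  `ι G₁ = L_p(E,T)`: `col(loc z) ∈ Λ·G₁` for every `z ∈ Z` (integral shadow of
  `col(loc Z(f,T)) = Λ·u·G₁`; no (12.5.2): that hypothesis of p. 280 prices Thm. 12.5 (4) only). -/
  col_loc_mem_span : W.HasIrreducibleModPGaloisRep p → ∀ G₁ : IwasawaAlgebra p,
    iwasawaToPowerSeries p G₁ = padicLFunction f (unitRoot W p : ℚ_[p]) →
      ∀ z ∈ Z, col (loc z) ∈ Ideal.span {G₁}
  /-- (F1a) The ZETA LINE through Thm. 12.6's finite index (p. 222: "`Z(f,T)/Z` is a finite group",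
  hence `𝔪^m·Z(f,T) ⊂ Z` for `𝔪 = (p, T)` and some `m`) with Thm. 16.6 (2) (p. 271), 17.5 (p. 274) and
  Prop. 17.11 (p. 277) for a good `γ₀ ∈ T` (`col(loc z_{γ₀}) = L_{p-adic,α,ω_Néron,γ₀}(f) = u · ι G₁`,
  `u ∈ Λˣ` the period-ratio unit, A25 / Greenberg–Vatsal §3 and Prop. 3.7): under `Irr(E[p])`, for
  `G₁ ∈ Λ` with `ι G₁ = L_p(E,T)`, there are `m`, a unit `u`, and `wp, wT ∈ Z` (reading
  `wp = p^m z_{γ₀}`, `wT = T^m z_{γ₀}`) with `T^m • wp = p^m • wT`, `col(loc wp) = p^m·u·G₁` and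
  `col(loc wT) = T^m·u·G₁`.  Integral shadow (no `𝐇¹ ⊗ ℚ`, no `z_γ`); no (12.5.2). -/
  exists_zetaLine : W.HasIrreducibleModPGaloisRep p → ∀ G₁ : IwasawaAlgebra p,
    iwasawaToPowerSeries p G₁ = padicLFunction f (unitRoot W p : ℚ_[p]) →
      ∃ (m : ℕ) (u : (IwasawaAlgebra p)ˣ) (wp wT : I.H), wp ∈ Z ∧ wT ∈ Z ∧
        (PowerSeries.X : IwasawaAlgebra p) ^ m • wp =
          (PowerSeries.C (p : ℤ_[p]) : IwasawaAlgebra p) ^ m • wT ∧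
        col (loc wp) = (PowerSeries.C (p : ℤ_[p]) : IwasawaAlgebra p) ^ m * u * G₁ ∧
        col (loc wT) = (PowerSeries.X : IwasawaAlgebra p) ^ m * u * G₁

attribute [instance] DivisibilityInputsZetaLine.addCommGroupP DivisibilityInputsZetaLine.moduleP
  DivisibilityInputsZetaLine.addCommGroupH2 DivisibilityInputsZetaLine.moduleH2
  DivisibilityInputsZetaLine.addCommGroupH2loc DivisibilityInputsZetaLine.moduleH2loc

end Package

/-! ## Theorems: the old field and the old package from the restated one -/

section ToOld

variable {W : WeierstrassCurve ℚ} [W.IsElliptic] [W.IsGloballyMinimal] {p : ℕ} [Fact p.Prime]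
  [ContinuousSMul ℤ_[p] (W.tateModule p)] {N : ℕ} {f : CuspForm (Gamma0 N) 2}
  {κ : ZpExtension ℚ p} {γ : absoluteGaloisGroup ℚ}
  {I : IwasawaH1Data W p κ γ} {D : W.SelmerDualData κ γ}

/-- **The field `image_zeta_localized` of `Kato2004.DivisibilityInputs` is a THEOREM of the restated
package**: under `Irr(E[p])`, for `G₁ ∈ Λ` with `ι G₁ = L_p(E,T)` and EVERY height-one prime `𝔭`
(`𝔭 ∋ p` included), some `s ∉ 𝔭` has `s·G₁ ∈ col(loc Z)` and `s·col(loc z) ∈ (G₁)` for all `z ∈ Z`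
— from (F1a) `exists_zetaLine` and (F1b) `col_loc_mem_span` by `imageLocalized_of_zetaLine` (witnesses
`T^m` at `(p)`, `p^m` elsewhere).  Kato p. 280 "By 17.11 and by 12.5, 16.6 … sends the image of
`Z(f,T)(k)_𝔭` onto `Λ_𝔭 · L_{p-adic,α,ω,γ}(f)`", with Thm. 12.6 (`Z_𝔭 = Z(f,T)_𝔭` at height one); no
(12.5.2). [cite: Kato2004Asterisque, Thm. 12.6 (p. 222), Thm. 16.6 (2) (p. 271), Prop. 17.11 (p. 277) and §17.13 (p. 280)] -/
theorem DivisibilityInputsZetaLine.image_zeta_localized (K : DivisibilityInputsZetaLine W p f κ γ I D) :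
    W.HasIrreducibleModPGaloisRep p → ∀ G₁ : IwasawaAlgebra p,
      iwasawaToPowerSeries p G₁ = padicLFunction f (unitRoot W p : ℚ_[p]) →
        ∀ 𝔭 : PrimeSpectrum (IwasawaAlgebra p), 𝔭.asIdeal.height = 1 →
          ∃ s : IwasawaAlgebra p, s ∉ 𝔭.asIdeal ∧
            s * G₁ ∈ Submodule.map (K.col ∘ₗ K.loc) K.Z ∧
            ∀ z ∈ K.Z, s * K.col (K.loc z) ∈ Ideal.span {G₁} := by
  intro hirr G₁ hG₁
  obtain ⟨m, u, wp, wT, hwp, hwT, -, hcwp, hcwT⟩ := K.exists_zetaLine hirr G₁ hG₁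
  exact imageLocalized_of_zetaLine K.loc K.col K.Z G₁ m u wp wT hwp hwT hcwp hcwT
    (K.col_loc_mem_span hirr G₁ hG₁)

/-- **The old §17.13 package from the restated one**: every shared field is carried over unchanged
and `image_zeta_localized` is the theorem above.  Consumers of `Kato2004.DivisibilityInputs` are fed
`K.toDivisibilityInputs` with no further edit (`toDivisibilityInputs_Z/_loc/_col/_toX` are `rfl`).
[cite: Kato2004Asterisque, §17.13 (pp. 279–280)] -/
def DivisibilityInputsZetaLine.toDivisibilityInputs (K : DivisibilityInputsZetaLine W p f κ γ I D) :
    DivisibilityInputs W p f κ γ I D where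
  P := K.P
  H2 := K.H2
  H2loc := K.H2loc
  finite_H2 := K.finite_H2
  isTorsion_H2 := K.isTorsion_H2
  loc := K.loc
  toX := K.toX
  δ := K.δ
  ε := K.ε
  loc_injective := K.loc_injective
  exact_P := K.exact_P
  exact_X := K.exact_X
  exact_H2 := K.exact_H2
  finite_H2loc := K.finite_H2loc
  col := K.col
  col_injective := K.col_injective
  finite_coker_col := K.finite_coker_col
  Z := K.Z
  n := K.n
  G := K.G
  ιG_eq := K.ιG_eq
  pow_mem := K.pow_mem
  es_bound := K.es_bound
  integral := K.integral
  image_zeta_localized := K.image_zeta_localized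

/-- The zeta submodule is unchanged by `toDivisibilityInputs`. [cite: Kato2004Asterisque, Thm. 12.6 (p. 222)] -/
@[simp] theorem DivisibilityInputsZetaLine.toDivisibilityInputs_Z
    (K : DivisibilityInputsZetaLine W p f κ γ I D) : K.toDivisibilityInputs.Z = K.Z := rfl

/-- The map `𝐇¹ → P` is unchanged by `toDivisibilityInputs`. [cite: Kato2004Asterisque, §17.13 (17.13.1) (p. 279)] -/
@[simp] theorem DivisibilityInputsZetaLine.toDivisibilityInputs_loc
    (K : DivisibilityInputsZetaLine W p f κ γ I D) : K.toDivisibilityInputs.loc = K.loc := rfl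

/-- The Coleman map is unchanged by `toDivisibilityInputs`. [cite: Kato2004Asterisque, Prop. 17.11 (p. 277)] -/
@[simp] theorem DivisibilityInputsZetaLine.toDivisibilityInputs_col
    (K : DivisibilityInputsZetaLine W p f κ γ I D) : K.toDivisibilityInputs.col = K.col := rfl

/-- The map `P → X` is unchanged by `toDivisibilityInputs`. [cite: Kato2004Asterisque, §17.13 (17.13.1) (p. 279)] -/
@[simp] theorem DivisibilityInputsZetaLine.toDivisibilityInputs_toX
    (K : DivisibilityInputsZetaLine W p f κ γ I D) : K.toDivisibilityInputs.toX = K.toX := rfl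

/-- The map `X → 𝐇²` is unchanged by `toDivisibilityInputs`. [cite: Kato2004Asterisque, §17.13 (17.13.1) (p. 279)] -/
@[simp] theorem DivisibilityInputsZetaLine.toDivisibilityInputs_δ
    (K : DivisibilityInputsZetaLine W p f κ γ I D) : K.toDivisibilityInputs.δ = K.δ := rfl

/-- The element `G = p^n·L_p` is unchanged by `toDivisibilityInputs`. [cite: Kato2004Asterisque, Thm. 17.4 (2) (p. 273)] -/
@[simp] theorem DivisibilityInputsZetaLine.toDivisibilityInputs_G
    (K : DivisibilityInputsZetaLine W p f κ γ I D) : K.toDivisibilityInputs.G = K.G := rfl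

end ToOld

/-! ## The named fact: the restated F1 (package with the zeta line + fine quotient + Thm. 12.6 span clause) -/

/-- **Kato 2004, Thm. 12.4 (1), 12.5 (1)–(4), 12.6, 16.6, 17.5, 17.11 and §17.13 for `T ≅ T_pE(−1)`,
`k = 2`, with Ex. 13.3 (p. 225), (14.9.3) (p. 240) and (17.13.1) (p. 279): the §17.13 package WITH THE
ZETA LINE exists on the pinned pair `(𝐇¹_Γ(T_pW), X(E/ℚ_∞))`, together with (i) a SURJECTIVE fine
quotient `π : X(E/ℚ_∞) ↠ X₀(E/ℚ_∞)` exact after `P → X` and (ii) the zeta submodule `K.Z` contained in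
the `Λ`-span of GENUINE Λ-adic Euler-system classes (Thm. 12.6 as printed, `IsEulerSystemClass`).**
This is `Kato2004.exists_divisibilityInputs_fineQuotient_zeta` (file `EulerSystemClasses`, whose
docstring carries the printed content of clauses (i)(ii)) with the package `DivisibilityInputs` replaced
by `DivisibilityInputsZetaLine`: same binders (every elliptic `E/ℚ` with globally minimal model `W`,
structure facts of `T_pW` as instance BINDERS, every ODD good ordinary `p`, cyclotomic `κ` with
topological generator `γ` matching the cyclotomic variable, every newform `f` of `W`, every `I, D, Y`),
same three clauses.  A CONSTRUCTION fact: its content is that Kato's objects (`𝐇¹_loc(T(k))/𝐇¹_loc(T'(k))`,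
`𝐇²`, `𝐇²_loc`, the Poitou–Tate maps, `𝔏_η`, the span of the integral zeta elements, the classes
`p^m z_{γ₀}`, `T^m z_{γ₀}` for a good `γ₀` — `Δ`-trivial components; READING of `DivisibilityInputs.lean`)
satisfy the listed printed statements; weaker than print (identity of `P, 𝐇², 𝐇²_loc, π` forgotten; `Z`
only bounded above by the span), never stronger; implies the old fact
(`exists_divisibilityInputs_fineQuotient_zeta_of_zetaLine`).  Nothing asserted; no `_holds` expected soon.
[cite: Kato2004Asterisque, Thm. 12.4 (1) (p. 221), Thm. 12.5 (1)–(4) (pp. 221–222), Thm. 12.6 (p. 222), Ex. 13.3 (p. 225), (14.9.3) (p. 240), Thm. 16.6 (p. 271), 17.5 (p. 274), Prop. 17.11 (p. 277), §17.13 (17.13.1)–(17.13.4) (pp. 279–280)]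
[cite: GreenbergVatsal2000, §3 Remark 3.4 and Prop. 3.7] -/
def exists_divisibilityInputsZetaLine_fineQuotient_zeta : Prop :=
  ∀ (W : WeierstrassCurve ℚ) [W.IsElliptic] [W.IsGloballyMinimal] (p : ℕ) [Fact p.Prime]
    [ContinuousSMul ℤ_[p] (W.tateModule p)] [Module.Free ℤ_[p] (W.tateModule p)]
    [Module.Finite ℤ_[p] (W.tateModule p)] {N : ℕ} [NeZero N] (f : CuspForm (Gamma0 N) 2)
    (κ : ZpExtension ℚ p) (γ : absoluteGaloisGroup ℚ),
    p ≠ 2 → IsOrdinaryAt W p → κ.IsCyclotomic → κ.IsTopGenerator γ → IsCyclotomicVariable p γ →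
    IsNewformOf W f →
    ∀ (I : IwasawaH1Data W p κ γ) (D : W.SelmerDualData κ γ) (Y : W.FineSelmerDualData κ γ),
      ∃ (K : DivisibilityInputsZetaLine W p f κ γ I D) (π : D.X →ₗ[IwasawaAlgebra p] Y.X),
        Function.Surjective π ∧ Function.Exact K.toX π ∧
        K.Z ≤ Submodule.span (IwasawaAlgebra p) {s : I.H | IsEulerSystemClass W p κ γ I s}

/-! ## Theorems: the restated fact implies the old facts (porting terms for every consumer) -/

/-- **Restated F1 ⟹ old F1.**  `exists_divisibilityInputsZetaLine_fineQuotient_zeta` implies the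
tree's `Kato2004.exists_divisibilityInputs_fineQuotient_zeta` (same `π`, package `K.toDivisibilityInputs`,
whose `toX` and `Z` are those of `K`).  Every consumer `(hF1 : exists_divisibilityInputs_fineQuotient_zeta)`
ports by feeding `exists_divisibilityInputs_fineQuotient_zeta_of_zetaLine hF1'`.
[cite: Kato2004Asterisque, Thm. 12.6 (p. 222) and §17.13 (pp. 279–280)] -/
theorem exists_divisibilityInputs_fineQuotient_zeta_of_zetaLine
    (h : exists_divisibilityInputsZetaLine_fineQuotient_zeta) :
    exists_divisibilityInputs_fineQuotient_zeta := by
  intro W _ _ p _ _ _ _ N _ f κ γ hp hord hκ hγ hγ' hf I D Y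
  obtain ⟨K, π, hπs, hπ, hZ⟩ := h W p f κ γ hp hord hκ hγ hγ' hf I D Y
  exact ⟨K.toDivisibilityInputs, π, hπs, hπ, hZ⟩

/-- **Restated F1 ⟹ the fine-quotient fact** `Kato2004.exists_divisibilityInputs_fineQuotient`
(file `DivisibilityInputsFine`; drops the span clause).
[cite: Kato2004Asterisque, (14.9.3) (p. 240) and §17.13 (p. 279)] -/
theorem exists_divisibilityInputs_fineQuotient_of_zetaLine
    (h : exists_divisibilityInputsZetaLine_fineQuotient_zeta) :
    ∀ (W : WeierstrassCurve ℚ) [W.IsElliptic] [W.IsGloballyMinimal] (p : ℕ) [Fact p.Prime]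
      [ContinuousSMul ℤ_[p] (W.tateModule p)] [Module.Free ℤ_[p] (W.tateModule p)]
      [Module.Finite ℤ_[p] (W.tateModule p)] {N : ℕ} [NeZero N] (f : CuspForm (Gamma0 N) 2)
      (κ : ZpExtension ℚ p) (γ : absoluteGaloisGroup ℚ),
      p ≠ 2 → IsOrdinaryAt W p → κ.IsCyclotomic → κ.IsTopGenerator γ → IsCyclotomicVariable p γ →
      IsNewformOf W f →
      ∀ (I : IwasawaH1Data W p κ γ) (D : W.SelmerDualData κ γ) (Y : W.FineSelmerDualData κ γ),
        ∃ (K : DivisibilityInputs W p f κ γ I D) (π : D.X →ₗ[IwasawaAlgebra p] Y.X),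
          Function.Surjective π ∧ Function.Exact K.toX π :=
  exists_divisibilityInputs_fineQuotient_of_zeta (exists_divisibilityInputs_fineQuotient_zeta_of_zetaLine h)

/-- **Restated F1 ⟹ `Kato2004.exists_divisibilityInputs`** restricted to the structure-fact binders of
`T_pW` the restated fact carries (`Module.Free`, `Module.Finite` over `ℤ_p`): the old package is
inhabited. [cite: Kato2004Asterisque, §17.13 (pp. 279–280)] -/
theorem nonempty_divisibilityInputs_of_zetaLine
    (h : exists_divisibilityInputsZetaLine_fineQuotient_zeta)
    (W : WeierstrassCurve ℚ) [W.IsElliptic] [W.IsGloballyMinimal] (p : ℕ) [Fact p.Prime]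
    [ContinuousSMul ℤ_[p] (W.tateModule p)] [Module.Free ℤ_[p] (W.tateModule p)]
    [Module.Finite ℤ_[p] (W.tateModule p)] {N : ℕ} [NeZero N] (f : CuspForm (Gamma0 N) 2)
    (κ : ZpExtension ℚ p) (γ : absoluteGaloisGroup ℚ) (hp : p ≠ 2) (hord : IsOrdinaryAt W p)
    (hκ : κ.IsCyclotomic) (hγ : κ.IsTopGenerator γ) (hγ' : IsCyclotomicVariable p γ)
    (hf : IsNewformOf W f) (I : IwasawaH1Data W p κ γ) (D : W.SelmerDualData κ γ) :
    Nonempty (DivisibilityInputs W p f κ γ I D) := by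
  obtain ⟨Y⟩ := W.nonempty_fineSelmerDualData κ hγ
  obtain ⟨K, -, -⟩ := h W p f κ γ hp hord hκ hγ hγ' hf I D Y
  exact ⟨K.toDivisibilityInputs⟩

end Literature.NumberTheory.EllipticCurves.Kato2004

end
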